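import Summits.BirchSwinnertonDyer.BirchSwinnertonDyer.Theorems.AlignedTransportAtTwoMainConjectureOfRankZeroBSDAtTwoSexticNormRelationDescentSignFreeMu
import Literature.NumberTheory.IwasawaTheory.ClassicalMuVanishesFiniteDescentNoGrowth
import Literature.NumberTheory.IwasawaTheory.ClassicalMuVanishesImaginaryQuadraticTwoProofs
import HarnessLib

/-!
# Route `AlignedTransportAtTwo`, crux C2 `MainConjectureOfRankZeroBSDAtTwo` (stmt-BirchSwinnertonDyer-22298):
# THE `S₃` NORM-RELATION DESCENT AT `p = 2`, SIGN-FREE — part C: `μ₂(ℚ(W[2])^{cyc}) = 0 ⟺ μ₂(ℚ(β_j)^{cyc}) = 0 ∧ μ₂(ℚ(√Δ_W)^{cyc}) = 0`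
# (both signs of `Δ_W`), and `⟺ μ₂(ℚ(β_j)^{cyc}) = 0` alone on `Δ_W < 0`

Sequel of `…SexticNormRelationDescentSignFree{,Mu}` (same seat bsd-line-att-p4 g29). HONEST FRAMING: WIDTH-5 attached prover seat on line `birth` of
the lead `bsd-line-att-p2`; `--supports` stmt-BirchSwinnertonDyer-22298, closes nothing; BSD is NOT proved; crux C2, its verdict «blocked-on
`Rank1Residual.GreenbergMuConjectureIrreducible`» and every registered stub untouched. THEOREMS ONLY.

WHAT. `W/ℚ` elliptic; `T = ℚ(W[2]) ⊆ ℚ̄`, `β_j` the roots of the `2`-division cubic, `δ = 4δ₀` (`δ² = Δ_W`); all `μ₂` in Iwasawa's growth form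
(`ClassicalMuVanishes`) for cyclotomic `ℤ₂`-extensions.

* §1 (no hypothesis on `W`) `μ₂(T) = 0 ⟹ μ₂(ℚ(β_j)) = 0` and `⟹ μ₂(ℚ(δ)) = 0`: Iwasawa 1973 §3 «`μ(K/k) ≤ μ(K'/k')`», the tree's hI-free finite descent
  `classicalMuVanishes_of_isCyclotomic_of_le_noGrowth` (cell bsd-2adic) along `ℚ(β_j) ≤ T`, `ℚ(δ) ≤ T` (the cubic half is also the tree's
  `classicalMu_cubicField_of_classicalMu_divisionField_two`, root-keyed; here keyed to `xT`).
* §2 ★★ `classicalMuVanishes_divisionField_two_iff` — for `W` with no rational `2`-torsion abscissa, `Δ_W ∉ ℚ²`, `2Δ_W ∉ ℚ²` (BOTH signs):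
  **`(∀ κ_T, μ₂ = 0) ⟺ (∀ j κ_j, μ₂ = 0) ∧ (∀ κ_δ, μ₂ = 0)`** — `⟸` is part B's sign-free `S₃` norm-relation descent.
* §3 `Δ_W < 0`: the resolvent conjunct is a THEOREM (`ℚ(δ)` imaginary quadratic: tree `classicalMuVanishes_imaginaryQuadratic_cyclotomic_two`, genus theory,
  cell bsd-potss) ⟹ ★★ `classicalMuVanishes_divisionField_two_iff_cubic_of_Δ_neg`: **`μ₂(ℚ(W[2])^{cyc}) = 0 ⟺ μ₂(ℚ(β_j)^{cyc}) = 0 (all `j`)`**, kernel,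
  unconditional — the lead's SEXTIC CRITERION (`…SexticCriterion`, `Δ_W < 0` half-cell: C2 ⟺ «μ₂(ℚ(W[2])) = 0 for every cell curve», modulo print) and
  att-p5 g24's CUBIC road therefore price the SAME Iwasawa datum, as an equivalence of tower statements (not only of crux-level consequences).
* §4 on C2's own binders (`W` globally minimal, `IsOrdinaryAt W 2`, no rational `2`-torsion abscissa, `Δ_W ∉ ℚ²`; `2Δ_W ∉ ℚ²` by part A §0):
  `classicalMuVanishes_divisionField_two_iff_of_isOrdinaryAt`.

References: [Iwasawa1973MuInvariants] §3; [BiasseEtAl2022] Prop. 3.7; [Washington1997] Prop. 4.11, §13.1; [Kida1979Tohoku] Thm. 1; [Ferrero1980AJM] Thm.;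
tree: parts A–B (this seat), `ClassicalMuVanishesFiniteDescentNoGrowth` (cell bsd-2adic), `ClassicalMuVanishesImaginaryQuadraticTwoProofs` (cell bsd-potss),
`…SexticCriterion` (lead att-p2 g4), `…CubicRankCertificateNecessity` / `…CubicCarrierRoad` (att-p5).
-/

set_option linter.dupNamespace false
set_option autoImplicit false

noncomputable section

open scoped Classical NumberField

namespace Summit.BirchSwinnertonDyer.BirchSwinnertonDyer.Theorems.AlignedTransportAtTwoSexticNormRelationDescentSignFreeIff

open NumberField Polynomial WeierstrassCurve IntermediateField Field
  Literature.NumberTheory.EllipticCurves Literature.NumberTheory.EllipticCurves.Greenberg1999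
  Literature.NumberTheory.EllipticCurves.DokchitserDokchitser2012
  Literature.NumberTheory.EllipticCurves.ZpExtension Literature.NumberTheory.GaloisRepresentations
  Literature.NumberTheory.IwasawaTheory Literature.NumberTheory.NumberFields
  Summit.BirchSwinnertonDyer.BirchSwinnertonDyer.Theorems.AlignedTransportAtTwoFineRoad.DivisionCubic
  Summit.BirchSwinnertonDyer.BirchSwinnertonDyer.Theorems.AlignedTransportAtTwoFineRoad.TowerImageDelta
  Summit.BirchSwinnertonDyer.BirchSwinnertonDyer.Theorems.AlignedTransportAtTwoCubicClosureParity
  Summit.BirchSwinnertonDyer.BirchSwinnertonDyer.Theorems.AlignedTransportAtTwoSexticTowerGrowth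
  Summit.BirchSwinnertonDyer.BirchSwinnertonDyer.Theorems.AlignedTransportAtTwoSexticNormRelationDescent
  Summit.BirchSwinnertonDyer.BirchSwinnertonDyer.Theorems.AlignedTransportAtTwoSexticNormRelationDescentMu
  Summit.BirchSwinnertonDyer.BirchSwinnertonDyer.Theorems.AlignedTransportAtTwoSexticNormRelationDescentSignFree
  Summit.BirchSwinnertonDyer.BirchSwinnertonDyer.Theorems.AlignedTransportAtTwoSexticNormRelationDescentSignFreeMu

variable (W : WeierstrassCurve ℚ) [W.IsElliptic]

/-! ## §1 The two easy descents `T → ℚ(β_j)`, `T → ℚ(δ)` (no hypothesis on `W`) -/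

/-- **`μ₂(ℚ(W[2])^{cyc}) = 0 ⟹ μ₂(ℚ(β_j)^{cyc}) = 0`** (`ℚ(β_j) ≤ ℚ(W[2])`; Iwasawa 1973 §3, finite descent without the growth theorem).
[cite: Iwasawa1973MuInvariants, §3 (remark after Thm. 2)] [cite: Washington1997, Prop. 4.11 and §13.1] -/
theorem classicalMuVanishes_cubic_of_divisionField_two
    (hT : ∀ κT : ZpExtension (W.divisionField 2) 2, κT.IsCyclotomic → ClassicalMuVanishes κT) (j : Fin 3)
    (κj : ZpExtension ↥ℚ⟮xT W two_ne_zero j⟯ 2) (hκj : κj.IsCyclotomic) : ClassicalMuVanishes κj := by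
  haveI : FiniteDimensional ℚ ↥ℚ⟮xT W two_ne_zero j⟯ :=
    IntermediateField.adjoin.finiteDimensional ((AlgebraicClosure.isAlgebraic ℚ).isAlgebraic _).isIntegral
  haveI : NumberField ↥ℚ⟮xT W two_ne_zero j⟯ := NumberField.mk
  haveI : NumberField (W.divisionField 2) := NumberField.mk
  have hle : ℚ⟮xT W two_ne_zero j⟯ ≤ W.divisionField 2 := adjoin_simple_le_iff.mpr (xT_mem W j)
  exact classicalMuVanishes_of_isCyclotomic_of_le_noGrowth hle hT κj hκj

/-- **`μ₂(ℚ(W[2])^{cyc}) = 0 ⟹ μ₂(ℚ(δ)^{cyc}) = 0`** (`ℚ(δ) ≤ ℚ(W[2])`, `δ = 4δ₀`; finite descent without the growth theorem).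
[cite: Iwasawa1973MuInvariants, §3 (remark after Thm. 2)] [cite: Washington1997, Prop. 4.11 and §13.1] -/
theorem classicalMuVanishes_resolvent_of_divisionField_two
    (hT : ∀ κT : ZpExtension (W.divisionField 2) 2, κT.IsCyclotomic → ClassicalMuVanishes κT)
    (κk : ZpExtension ↥ℚ⟮4 * delta W two_ne_zero⟯ 2) (hκk : κk.IsCyclotomic) : ClassicalMuVanishes κk := by
  haveI : FiniteDimensional ℚ ↥ℚ⟮4 * delta W two_ne_zero⟯ :=
    IntermediateField.adjoin.finiteDimensional ((AlgebraicClosure.isAlgebraic ℚ).isAlgebraic _).isIntegral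
  haveI : NumberField ↥ℚ⟮4 * delta W two_ne_zero⟯ := NumberField.mk
  haveI : NumberField (W.divisionField 2) := NumberField.mk
  have hle : ℚ⟮4 * delta W two_ne_zero⟯ ≤ W.divisionField 2 := adjoin_simple_le_iff.mpr (delta_mem_and_sq W).1
  exact classicalMuVanishes_of_isCyclotomic_of_le_noGrowth hle hT κk hκk

/-! ## §2 The equivalence, both signs of `Δ_W` -/

/-- ★★ **`μ₂(ℚ(W[2])^{cyc}) = 0 ⟺ μ₂(ℚ(β_j)^{cyc}) = 0 (∀ j) ∧ μ₂(ℚ(δ)^{cyc}) = 0`**, for `W/ℚ` elliptic with no rational `2`-torsion abscissa, `Δ_W ∉ ℚ²`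
and `2Δ_W ∉ ℚ²` (BOTH signs of `Δ_W`; all cyclotomic `ℤ₂`-extensions, growth form). `⟹`: §1; `⟸`: part B's sign-free `S₃` norm-relation descent.
[cite: BiasseEtAl2022, Prop. 3.7] [cite: Iwasawa1973MuInvariants, §3] [cite: Washington1997, §13.1] -/
theorem classicalMuVanishes_divisionField_two_iff (ht : ∀ x : ℚ, ¬ HasRationalTwoTorsionX W x) (hsq : ¬ IsSquare W.Δ)
    (h2Δ : ¬ IsSquare (2 * W.Δ)) :
    (∀ κT : ZpExtension (W.divisionField 2) 2, κT.IsCyclotomic → ClassicalMuVanishes κT) ↔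
      ((∀ j : Fin 3, ∀ κj : ZpExtension ↥ℚ⟮xT W two_ne_zero j⟯ 2, κj.IsCyclotomic → ClassicalMuVanishes κj) ∧
        ∀ κk : ZpExtension ↥ℚ⟮4 * delta W two_ne_zero⟯ 2, κk.IsCyclotomic → ClassicalMuVanishes κk) :=
  ⟨fun hT ↦ ⟨fun j κj hκj ↦ classicalMuVanishes_cubic_of_divisionField_two W hT j κj hκj,
      fun κk hκk ↦ classicalMuVanishes_resolvent_of_divisionField_two W hT κk hκk⟩,
    fun h κT hκT ↦ classicalMuVanishes_divisionField_two_of_cubic_of_resolvent_of_not_isSquare W ht hsq h2Δ h.1 h.2 κT hκT⟩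

/-! ## §3 `Δ_W < 0`: the resolvent conjunct is free -/

/-- **`μ₂(ℚ(δ)^{cyc}) = 0` for `Δ_W < 0`, unconditionally** (`ℚ(δ)` is imaginary quadratic: Kida 1979 / Ferrero 1980 in the tree's kernel form
`classicalMuVanishes_imaginaryQuadratic_cyclotomic_two`, genus theory along `ℚ(δ)·ℚ_n`). [cite: Kida1979Tohoku, Thm. 1] [cite: Ferrero1980AJM, Thm.] -/
theorem classicalMuVanishes_resolvent_of_Δ_neg (hΔ : W.Δ < 0)
    (κk : ZpExtension ↥ℚ⟮4 * delta W two_ne_zero⟯ 2) (hκk : κk.IsCyclotomic) : ClassicalMuVanishes κk := by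
  haveI : FiniteDimensional ℚ ↥ℚ⟮4 * delta W two_ne_zero⟯ :=
    IntermediateField.adjoin.finiteDimensional ((AlgebraicClosure.isAlgebraic ℚ).isAlgebraic _).isIntegral
  haveI : NumberField ↥ℚ⟮4 * delta W two_ne_zero⟯ := NumberField.mk
  have hsq : ¬ IsSquare W.Δ := fun ⟨r, hr⟩ ↦ by nlinarith [mul_self_nonneg r]
  have hδ := (delta_mem_and_sq W).2
  have h2 : Module.finrank ℚ ↥ℚ⟮4 * delta W two_ne_zero⟯ = 2 := finrank_adjoin_eq_two_of_sq_eq hδ hsq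
  have hd : ((⟨4 * delta W two_ne_zero, mem_adjoin_simple_self ℚ _⟩ : ↥ℚ⟮4 * delta W two_ne_zero⟯) : ↥ℚ⟮4 * delta W two_ne_zero⟯) ^ 2 =
      ((W.Δ : ℚ) : ↥ℚ⟮4 * delta W two_ne_zero⟯) := by
    apply Subtype.ext
    push_cast
    exact hδ
  have htc : IsTotallyComplex ↥ℚ⟮4 * delta W two_ne_zero⟯ := isTotallyComplex_of_sq_eq_ratCast hd hΔ
  exact classicalMuVanishes_imaginaryQuadratic_cyclotomic_two _ ⟨h2, htc⟩ κk hκk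

/-- ★★ **`Δ_W < 0`: `μ₂(ℚ(W[2])^{cyc}) = 0 ⟺ μ₂(ℚ(β_j)^{cyc}) = 0` for all `j`**, for every elliptic `W/ℚ` with no rational `2`-torsion abscissa and
`Δ_W < 0` (all cyclotomic `ℤ₂`-extensions, growth form) — KERNEL, unconditional: the sextic datum of the lead's SEXTIC CRITERION and the cubic datum of
the CUBIC road are one and the same tower statement. [cite: BiasseEtAl2022, Prop. 3.7] [cite: Iwasawa1973MuInvariants, §3] [cite: Ferrero1980AJM, Thm.] -/
theorem classicalMuVanishes_divisionField_two_iff_cubic_of_Δ_neg (ht : ∀ x : ℚ, ¬ HasRationalTwoTorsionX W x) (hΔ : W.Δ < 0) :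
    (∀ κT : ZpExtension (W.divisionField 2) 2, κT.IsCyclotomic → ClassicalMuVanishes κT) ↔
      ∀ j : Fin 3, ∀ κj : ZpExtension ↥ℚ⟮xT W two_ne_zero j⟯ 2, κj.IsCyclotomic → ClassicalMuVanishes κj := by
  have hsq : ¬ IsSquare W.Δ := fun ⟨r, hr⟩ ↦ by nlinarith [mul_self_nonneg r]
  have h2Δ : ¬ IsSquare (2 * W.Δ) := fun ⟨r, hr⟩ ↦ by nlinarith [mul_self_nonneg r]
  rw [classicalMuVanishes_divisionField_two_iff W ht hsq h2Δ]
  exact ⟨fun h ↦ h.1, fun h ↦ ⟨h, fun κk hκk ↦ classicalMuVanishes_resolvent_of_Δ_neg W hΔ κk hκk⟩⟩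

/-! ## §4 On C2's own binders -/

/-- ★ **On the crux's domain** (`W` globally minimal, good ordinary at `2`, no rational `2`-torsion abscissa, `Δ_W ∉ ℚ²`; BOTH signs of `Δ_W`):
**`μ₂(ℚ(W[2])^{cyc}) = 0 ⟺ μ₂(ℚ(β_j)^{cyc}) = 0 (∀ j) ∧ μ₂(ℚ(√Δ_W)^{cyc}) = 0`** (`2Δ_W ∉ ℚ²` discharged by part A §0). [cite: BiasseEtAl2022, Prop. 3.7]
[cite: Iwasawa1973MuInvariants, §3] [cite: SilvermanAEC2009, VII.5 Prop. 5.1(a)] -/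
theorem classicalMuVanishes_divisionField_two_iff_of_isOrdinaryAt [W.IsGloballyMinimal] (hord : IsOrdinaryAt W 2)
    (ht : ∀ x : ℚ, ¬ HasRationalTwoTorsionX W x) (hsq : ¬ IsSquare W.Δ) :
    (∀ κT : ZpExtension (W.divisionField 2) 2, κT.IsCyclotomic → ClassicalMuVanishes κT) ↔
      ((∀ j : Fin 3, ∀ κj : ZpExtension ↥ℚ⟮xT W two_ne_zero j⟯ 2, κj.IsCyclotomic → ClassicalMuVanishes κj) ∧
        ∀ κk : ZpExtension ↥ℚ⟮4 * delta W two_ne_zero⟯ 2, κk.IsCyclotomic → ClassicalMuVanishes κk) :=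
  classicalMuVanishes_divisionField_two_iff W ht hsq (not_isSquare_two_mul_Δ_of_isOrdinaryAt W hord)

end Summit.BirchSwinnertonDyer.BirchSwinnertonDyer.Theorems.AlignedTransportAtTwoSexticNormRelationDescentSignFreeIff

end
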